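import Summits.Ventures.PercRepro.S1TrianglePlusDeg
import Summits.Ventures.PercRepro.S1TrianglePlusFreeD
import Summits.Ventures.PercRepro.S1TrianglePlusPlus

/-!
# PercRepro — nullity `4`: at most five triangles under the line and plane bounds (p1, gen 20; base of T⁺⁺⁺)

Under (C1) and (C2) a matroid of nullity `4` has at most `5` triangles (LEMMA T⁺⁺ gives `6`; the engine's
core maximum is `5`). PROOF. Suppose `s₃ ≥ 6`. Every non-loop has degree `≤ 2` (`ncard_triangles_le_succ_of_degree`)
and some `x` has degree `2` (`ncard_triangles_le_of_degree_le_one`). `M' = M ＼ {x}` (nullity `3`) has exactly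
`4` triangles (T⁺⁺), all degrees `≤ 2`, and a point `y` of degree `2` whose cone `U'` (5 points, rank 3) is free
with one unit of nullity outside: the two triangles of `M'` avoiding `y` are `{f, a, b}`, `{f, a', b'}` with
`{a, b} ⊔ {a', b'} = U' ∖ {y}` (`free_cone_two_structure`). So every point of `K := U' ∪ {f}` lies on two
triangles of `M'`, the two triangles of `M` through `x` avoid `K`, and since `K` carries all the nullity of `M'`
their four other points are independent of rank `4` — but `x ∈ cl {p, q} ∩ cl {p', q'}` has rank `0`.
* **`ncard_triangles_le_five_of_nullity_four`** — `#(triangles M) ≤ 5` when `|E| = r(E) + 4`, (C1), (C2).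
Axioms: standard.
-/

open scoped Matroid

namespace PercRepro

namespace S1

open Set

variable {α : Type}

/-- **Nullity `4`: at most five triangles** under (C1) and (C2). -/
theorem ncard_triangles_le_five_of_nullity_four (M : Matroid α) [M.Finite]
    (hC1 : ∀ L ⊆ M.E, M.eRk L = 2 → L.ncard ≤ 3) (hC2 : ∀ P ⊆ M.E, M.eRk P ≤ 3 → P.ncard ≤ 6)
    (hd : M.E.encard = M.eRank + ((4 : ℕ) : ℕ∞)) : (ThmN.triangles M).ncard ≤ 5 := by
  classical
  by_contra hgt
  have h6 : 6 ≤ (ThmN.triangles M).ncard := by omega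
  have hSfin : (ThmN.triangles M).Finite :=
    M.ground_finite.finite_subsets.subset (fun C hC => hC.1.subset_ground)
  have hTfin : ∀ z, (ThmN.trianglesThrough M z).Finite :=
    fun z => M.ground_finite.finite_subsets.subset (fun C hC => hC.1.subset_ground)
  -- (A) every non-loop of `M` has degree `≤ 2`
  have hdeg2 : ∀ z, M.IsNonloop z → (ThmN.trianglesThrough M z).ncard ≤ 2 := by
    intro z hz
    by_contra h
    have h3 : 4 ≤ (ThmN.trianglesThrough M z).ncard + 1 := by omega
    have := ncard_triangles_le_succ_of_degree M hC1 hC2 hd hz h3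
    omega
  -- (B) some non-loop `x` has degree exactly `2`
  obtain ⟨x, hx, hx2⟩ : ∃ x, M.IsNonloop x ∧ (ThmN.trianglesThrough M x).ncard = 2 := by
    by_contra hno
    have hle1 : ∀ z, M.IsNonloop z → (ThmN.trianglesThrough M z).ncard ≤ 1 := by
      intro z hz
      have h2 := hdeg2 z hz
      have hne : (ThmN.trianglesThrough M z).ncard ≠ 2 := fun h => hno ⟨z, hz, h⟩
      omega
    have := ncard_triangles_le_of_degree_le_one M hC1 hd hle1
    omega
  have hxE : x ∈ M.E := hx.mem_ground
  -- (C) `M' = M ＼ {x}` has nullity `3` and exactly `4` triangles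
  set M' := M ＼ {x} with hM'
  have hne : ¬ M.IsColoop x := by
    obtain ⟨C, hC⟩ : (ThmN.trianglesThrough M x).Nonempty := by
      rw [← Set.ncard_pos (hTfin x)]; omega
    exact hC.1.not_isColoop_of_mem hC.2.2
  have hν : M✶.eRank = (4 : ℕ∞) := by
    have h := _root_.Matroid.eRank_add_eRank_dual M
    rw [hd] at h
    exact WithTop.add_left_cancel (PercRepro.Matroid.eRank_ne_top_of_finite M) h
  have hdel := PercRepro.Matroid.dual_eRank_delete_singleton_add_one hxE hne
  rw [hν] at hdel
  have hfin' : (M ＼ {x})✶.eRank ≠ ⊤ := by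
    intro h
    rw [h] at hdel
    exact absurd hdel (by simp)
  obtain ⟨d', hd'⟩ := ENat.ne_top_iff_exists.1 hfin'
  have hd3 : d' = 3 := by
    rw [← hd'] at hdel
    have h' : ((d' + 1 : ℕ) : ℕ∞) = ((4 : ℕ) : ℕ∞) := by push_cast; exact hdel
    have := Nat.cast_injective h'
    omega
  have hd'enc : M'.E.encard = M'.eRank + ((3 : ℕ) : ℕ∞) := by
    have h := _root_.Matroid.eRank_add_eRank_dual (M ＼ {x})
    rw [← hd', hd3] at h
    exact h.symm
  have hC1' : ∀ L ⊆ M'.E, M'.eRk L = 2 → L.ncard ≤ 3 := by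
    intro L hL hr
    rw [hM', _root_.Matroid.delete_ground] at hL
    rw [hM', delete_singleton_eRk_eq hL] at hr
    exact hC1 L (hL.trans sdiff_subset) hr
  have hC2' : ∀ P ⊆ M'.E, M'.eRk P ≤ 3 → P.ncard ≤ 6 := by
    intro P hP hr
    rw [hM', _root_.Matroid.delete_ground] at hP
    rw [hM', delete_singleton_eRk_eq hP] at hr
    exact hC2 P (hP.trans sdiff_subset) hr
  have hS'fin : (ThmN.triangles M').Finite :=
    M'.ground_finite.finite_subsets.subset (fun C hC => hC.1.subset_ground)
  have hS'eq : ThmN.triangles M' = {C | C ∈ ThmN.triangles M ∧ x ∉ C} := triangles_delete_eq M x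
  have hS'4 : (ThmN.triangles M').ncard = 4 := by
    have hup : 2 * (ThmN.triangles M').ncard + 3 * 3 ≤ 3 * 3 + 8 :=
      two_mul_ncard_triangles_add_three_mul_le M' hC1' hC2' hd'enc
    have hsplit : ThmN.triangles M ⊆ ThmN.trianglesThrough M x ∪ ThmN.triangles M' := by
      intro C hC
      by_cases h : x ∈ C
      · exact Or.inl ⟨hC.1, hC.2, h⟩
      · exact Or.inr (by rw [hS'eq]; exact ⟨hC, h⟩)
    have hlo : (ThmN.triangles M).ncard ≤ 2 + (ThmN.triangles M').ncard := by
      calc (ThmN.triangles M).ncard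
          ≤ (ThmN.trianglesThrough M x ∪ ThmN.triangles M').ncard :=
            ncard_le_ncard hsplit ((hTfin x).union hS'fin)
        _ ≤ (ThmN.trianglesThrough M x).ncard + (ThmN.triangles M').ncard := ncard_union_le _ _
        _ = 2 + (ThmN.triangles M').ncard := by rw [hx2]
    omega
  -- (D) degrees in `M'` are `≤ 2`, and some non-loop `y` of `M'` has degree `2`
  have hT'fin : ∀ z, (ThmN.trianglesThrough M' z).Finite :=
    fun z => M'.ground_finite.finite_subsets.subset (fun C hC => hC.1.subset_ground)
  have hdeg2' : ∀ z, M'.IsNonloop z → (ThmN.trianglesThrough M' z).ncard ≤ 2 := by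
    intro z hz
    exact (ncard_le_ncard (trianglesThrough_delete_subset M x z) (hTfin z)).trans
      (hdeg2 z hz.of_delete)
  obtain ⟨y, hy, hy2⟩ : ∃ y, M'.IsNonloop y ∧ (ThmN.trianglesThrough M' y).ncard = 2 := by
    by_contra hno
    have hle1 : ∀ z, M'.IsNonloop z → (ThmN.trianglesThrough M' z).ncard ≤ 1 := by
      intro z hz
      have h2 := hdeg2' z hz
      have hne : (ThmN.trianglesThrough M' z).ncard ≠ 2 := fun h => hno ⟨z, hz, h⟩
      omega
    have := ncard_triangles_le_of_degree_le_one M' hC1' hd'enc hle1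
    omega
  -- (E) the cone of `y` in `M'` is free
  set S'₁ := ThmN.trianglesThrough M' y with hS'₁
  have hS'₁fin : S'₁.Finite := hT'fin y
  set s := hS'₁fin.toFinset with hsdef
  have hmem : ∀ C, C ∈ s ↔ C ∈ S'₁ := fun C => Set.Finite.mem_toFinset hS'₁fin
  have hs : ∀ C ∈ s, C ∈ S'₁ := fun C hC => (hmem C).1 hC
  have hscard : s.card = 2 := by rw [hsdef, ← Set.ncard_eq_toFinset_card _ hS'₁fin, hy2]
  set U : Set α := {y} ∪ ⋃ C ∈ s, C with hU
  have hUE : U ⊆ M'.E := by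
    intro z hz
    rcases hz with hz | hz
    · rw [Set.mem_singleton_iff.1 hz]; exact hy.mem_ground
    · obtain ⟨C, hC, hzC⟩ := Set.mem_iUnion₂.1 hz
      exact (hs C hC).1.subset_ground hzC
  obtain ⟨hrU, hcU⟩ := ThmN.eRk_le_and_ncard_eq_of_triangles M' hC1' hy s hs
  have hcU' : U.ncard = 5 := by rw [hcU, hscard]
  obtain ⟨C₁, hC₁s⟩ : s.Nonempty := by rw [← Finset.card_pos, hscard]; norm_num
  have hfree : M'.eRk U = ((1 + s.card : ℕ) : ℕ∞) := by
    rw [hscard]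
    have hlo : (2 : ℕ∞) ≤ M'.eRk U := by
      rw [← ThmN.eRk_eq_two_of_mem_trianglesThrough M' (hs C₁ hC₁s)]
      exact M'.eRk_mono (fun z hz => Set.mem_union_right _ (Set.mem_iUnion₂.2 ⟨C₁, hC₁s, hz⟩))
    rw [hscard] at hrU
    have hneU : M'.eRk U ≠ ⊤ := by
      intro h; rw [h] at hrU; exact absurd hrU (by simp)
    obtain ⟨a, ha⟩ := ENat.ne_top_iff_exists.1 hneU
    rw [← ha] at hrU hlo ⊢
    have e1 : a ≤ 1 + 2 := by exact_mod_cast hrU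
    have e2 : 2 ≤ a := by exact_mod_cast hlo
    have hne2 : a ≠ 2 := by
      intro h2
      have := hC1' U hUE (by rw [← ha, h2]; norm_num)
      omega
    have : a = 3 := by omega
    rw [this]
  have hd'' : M'.E.encard = M'.eRank + ((s.card + 1 : ℕ) : ℕ∞) := by rw [hd'enc, hscard]
  -- (G) the two triangles of `M'` avoiding `y`
  set A := {T | T ∈ ThmN.triangles M' ∧ y ∉ T} with hA
  have hAfin : A.Finite := hS'fin.subset (fun T hT => hT.1)
  have hA2 : A.ncard = 2 := by
    have hsplit : ThmN.triangles M' = S'₁ ∪ A := by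
      ext C
      simp only [hS'₁, hA, ThmN.trianglesThrough, ThmN.triangles, Set.mem_union, Set.mem_setOf_eq]
      tauto
    have hdisj : Disjoint S'₁ A := by
      rw [Set.disjoint_left]
      rintro C hC ⟨-, hyC⟩
      exact hyC hC.2.2
    have := Set.ncard_union_eq hdisj hS'₁fin hAfin
    rw [← hsplit, hS'4, hy2] at this
    omega
  obtain ⟨T₁, T₂, h12, hAeq⟩ := Set.ncard_eq_two.1 hA2
  have h₁ : T₁ ∈ A := by rw [hAeq]; simp
  have h₂ : T₂ ∈ A := by rw [hAeq]; simp
  -- (H) the structure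
  obtain ⟨f, hfU, hfE, hfT₁, hfT₂, hZ₁, hZ₂, hn₁, hn₂, hdisj, C, hC, C', hC', hCC', hp₁, hp₂⟩ :=
    free_cone_two_structure M' hC1' hy s hmem hfree hd'' h₁ h₂ h12
  -- `s = {C, C'}` and `U ∖ {y} = (C ∪ C') ∖ {y}`
  have hsCC' : s = {C, C'} := by
    symm
    apply Finset.eq_of_subset_of_card_le
    · intro D hD
      simp only [Finset.mem_insert, Finset.mem_singleton] at hD
      rcases hD with rfl | rfl <;> assumption
    · rw [hscard, Finset.card_pair hCC']
  have hUeq : U = C ∪ C' := by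
    rw [hU, hsCC']
    ext w
    simp only [Set.mem_union, Set.mem_singleton_iff, Set.mem_iUnion, Finset.mem_insert,
      Finset.mem_singleton, exists_prop]
    constructor
    · rintro (rfl | ⟨D, (rfl | rfl), hwD⟩)
      · exact Or.inl (hs C hC).2.2
      · exact Or.inl hwD
      · exact Or.inr hwD
    · rintro (hw | hw)
      · exact Or.inr ⟨C, Or.inl rfl, hw⟩
      · exact Or.inr ⟨C', Or.inr rfl, hw⟩
  have hUfin : U.Finite := M'.ground_finite.subset hUE
  have hcover : U \ {y} = (T₁ ∩ U) ∪ (T₂ ∩ U) := by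
    symm
    apply Set.eq_of_subset_of_ncard_le
    · have hsub : (C ∪ C') \ {y} ⊆ U \ {y} := by rw [hUeq]
      exact Set.union_subset (hp₁.trans hsub) (hp₂.trans hsub)
    · rw [Set.ncard_union_eq hdisj ((M'.ground_finite.subset h₁.1.1.subset_ground).inter_of_left _)
        ((M'.ground_finite.subset h₂.1.1.subset_ground).inter_of_left _), hn₁, hn₂]
      have hc : (U \ {y}).ncard + 1 = U.ncard :=
        Set.ncard_sdiff_singleton_add_one (Set.mem_union_left _ (Set.mem_singleton y)) hUfin
      omega
    · exact hUfin.sdiff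
  -- (I) `K := U ∪ {f}`: every point of `K` lies on two triangles of `M'`
  set K : Set α := insert f U with hK
  have hKdeg : ∀ k ∈ K, 2 ≤ (ThmN.trianglesThrough M' k).ncard := by
    intro k hk
    rcases hk with rfl | hkU
    · -- `f` is on `T₁` and `T₂`
      have hT₁ : T₁ ∈ ThmN.trianglesThrough M' k := ⟨h₁.1.1, h₁.1.2, hfT₁⟩
      have hT₂ : T₂ ∈ ThmN.trianglesThrough M' k := ⟨h₂.1.1, h₂.1.2, hfT₂⟩
      exact (Set.one_lt_ncard (hT'fin k)).2 ⟨T₁, hT₁, T₂, hT₂, h12⟩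
    · by_cases hky : k = y
      · rw [hky, ← hS'₁, hy2]
      · -- `k ∈ U ∖ {y}` lies on a triangle through `y` and on `T₁` or `T₂`
        have hk' : k ∈ U \ {y} := ⟨hkU, hky⟩
        obtain ⟨D, hD, hkD⟩ : ∃ D ∈ s, k ∈ D := by
          rcases hkU with h | h
          · exact absurd (Set.mem_singleton_iff.1 h) hky
          · obtain ⟨D, hD, hkD⟩ := Set.mem_iUnion₂.1 h
            exact ⟨D, hD, hkD⟩
        have hDk : D ∈ ThmN.trianglesThrough M' k := ⟨(hs D hD).1, (hs D hD).2.1, hkD⟩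
        rw [hcover] at hk'
        rcases hk' with ⟨hkT, -⟩ | ⟨hkT, -⟩
        · have hTk : T₁ ∈ ThmN.trianglesThrough M' k := ⟨h₁.1.1, h₁.1.2, hkT⟩
          have hneq : D ≠ T₁ := fun h => h₁.2 (h ▸ (hs D hD).2.2)
          exact (Set.one_lt_ncard (hT'fin k)).2 ⟨D, hDk, T₁, hTk, hneq⟩
        · have hTk : T₂ ∈ ThmN.trianglesThrough M' k := ⟨h₂.1.1, h₂.1.2, hkT⟩
          have hneq : D ≠ T₂ := fun h => h₂.2 (h ▸ (hs D hD).2.2)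
          exact (Set.one_lt_ncard (hT'fin k)).2 ⟨D, hDk, T₂, hTk, hneq⟩
  -- (J) the triangles of `M` through `x` avoid `K`
  have hKavoid : ∀ D ∈ ThmN.trianglesThrough M x, ∀ k ∈ K, k ∉ D := by
    intro D hD k hk hkD
    have hkE : M.IsNonloop k := by
      have hkE' : k ∈ M'.E := by
        rcases hk with rfl | hkU
        · exact hfE
        · exact hUE hkU
      rw [hM', _root_.Matroid.delete_ground] at hkE'
      refine _root_.Matroid.isNonloop_of_not_isLoop hkE'.1 ?_
      intro hloop
      have := hloop.eq_of_isCircuit_mem hD.1 hkD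
      have h3 := hD.2.1
      rw [this, ncard_singleton] at h3
      omega
    have hsub : ThmN.trianglesThrough M' k ∪ {D} ⊆ ThmN.trianglesThrough M k := by
      apply Set.union_subset (trianglesThrough_delete_subset M x k)
      exact Set.singleton_subset_iff.2 ⟨hD.1, hD.2.1, hkD⟩
    have hDnot : D ∉ ThmN.trianglesThrough M' k := by
      intro hD'
      have := (_root_.Matroid.delete_isCircuit_iff.1 hD'.1).2
      rw [Set.disjoint_singleton_right] at this
      exact this hD.2.2
    have h3 : 3 ≤ (ThmN.trianglesThrough M k).ncard := by
      calc 3 ≤ (ThmN.trianglesThrough M' k).ncard + 1 := by have := hKdeg k hk; omega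
        _ = (ThmN.trianglesThrough M' k ∪ {D}).ncard := by
            rw [Set.union_singleton, Set.ncard_insert_of_notMem hDnot (hT'fin k)]
        _ ≤ (ThmN.trianglesThrough M k).ncard := ncard_le_ncard hsub (hTfin k)
    have := hdeg2 k hkE
    omega
  -- (K) `K` carries all the nullity of `M'`: every circuit of `M'` lies in `K`
  have hKE : K ⊆ M'.E := Set.insert_subset hfE hUE
  have hKcirc : ∀ {D : Set α}, M'.IsCircuit D → D ⊆ K := by
    have hfcl : f ∈ M'.closure U := by
      have h1 : f ∈ M'.closure (T₁ \ {f}) := h₁.1.1.mem_closure_sdiff_singleton_of_mem hfT₁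
      refine M'.closure_subset_closure ?_ h1
      intro w hw
      by_contra hwU
      have : w ∈ T₁ \ U := ⟨hw.1, hwU⟩
      rw [hZ₁] at this
      exact hw.2 this
    have hrK : M'.eRk K ≤ 3 := by
      have hsub : K ⊆ M'.closure U := Set.insert_subset hfcl (M'.subset_closure U hUE)
      calc M'.eRk K ≤ M'.eRk (M'.closure U) := M'.eRk_mono hsub
        _ = M'.eRk U := M'.eRk_closure_eq U
        _ = 3 := by rw [hfree, hscard]; norm_num
    have hcK : K.ncard = 6 := by
      rw [hK, Set.ncard_insert_of_notMem hfU hUfin, hcU']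
    have hneR : M'.eRank ≠ ⊤ :=
      (M'.eRank_le_encard_ground.trans_lt M'.ground_finite.encard_lt_top).ne
    obtain ⟨r, hr⟩ := ENat.ne_top_iff_exists.1 hneR
    have hcard : M'.E.ncard = K.ncard + (M'.E \ K).ncard := by
      conv_lhs => rw [← Set.union_sdiff_cancel hKE]
      exact Set.ncard_union_eq Set.disjoint_sdiff_right (hUfin.insert f) (M'.ground_finite.sdiff)
    have e3 : M'.E.ncard = r + 3 := by
      rw [← hr, ← M'.ground_finite.cast_ncard_eq] at hd'enc
      exact_mod_cast hd'enc
    have hneK : M'.eRk K ≠ ⊤ := by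
      intro h; rw [h] at hrK; exact absurd hrK (by simp)
    obtain ⟨a, ha⟩ := ENat.ne_top_iff_exists.1 hneK
    have e1 : a ≤ 3 := by rw [← ha] at hrK; exact_mod_cast hrK
    have hfull : M'.eRk K + (M'.E \ K).encard ≤ M'.eRank := by
      rw [← ha, ← hr, ← (M'.ground_finite.sdiff (t := K)).cast_ncard_eq]
      have : a + (M'.E \ K).ncard ≤ r := by omega
      exact_mod_cast this
    intro D hD
    exact IsCircuit.subset_of_eRk_add_encard_le M' hKE hfull hD
  -- (L) the two triangles of `M` through `x`
  obtain ⟨D₁, D₂, hD12, hDeq⟩ := Set.ncard_eq_two.1 hx2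
  have hD₁ : D₁ ∈ ThmN.trianglesThrough M x := by rw [hDeq]; simp
  have hD₂ : D₂ ∈ ThmN.trianglesThrough M x := by rw [hDeq]; simp
  have hinter : D₁ ∩ D₂ = {x} :=
    ThmN.inter_eq_singleton_of_mem_trianglesThrough M hC1 hD₁ hD₂ hD12
  set W : Set α := (D₁ ∪ D₂) \ {x} with hW
  have hD₁E : D₁ ⊆ M.E := hD₁.1.subset_ground
  have hD₂E : D₂ ⊆ M.E := hD₂.1.subset_ground
  have hD₁fin : D₁.Finite := M.ground_finite.subset hD₁E
  have hD₂fin : D₂.Finite := M.ground_finite.subset hD₂E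
  have hWfin : W.Finite := (hD₁fin.union hD₂fin).sdiff
  have hWcard : W.ncard = 4 := by
    have h5 : (D₁ ∪ D₂).ncard = 5 := by
      have := Set.ncard_union_add_ncard_inter D₁ D₂ hD₁fin hD₂fin
      rw [hinter, Set.ncard_singleton, hD₁.2.1, hD₂.2.1] at this
      omega
    have hc : W.ncard + 1 = (D₁ ∪ D₂).ncard :=
      Set.ncard_sdiff_singleton_add_one (Set.mem_union_left _ hD₁.2.2) (hD₁fin.union hD₂fin)
    omega
  -- (M) `W` is independent in `M'`, hence in `M`: it contains no circuit of `M'`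
  have hWE' : W ⊆ M'.E := by
    intro w hw
    rw [hM', _root_.Matroid.delete_ground]
    refine ⟨?_, hw.2⟩
    rcases hw.1 with h | h
    · exact hD₁E h
    · exact hD₂E h
  have hWK : Disjoint W K := by
    rw [Set.disjoint_left]
    rintro w ⟨hw, -⟩ hwK
    rcases hw with h | h
    · exact hKavoid D₁ hD₁ w hwK h
    · exact hKavoid D₂ hD₂ w hwK h
  have hWind : M'.Indep W := by
    rw [_root_.Matroid.indep_iff_forall_subset_not_isCircuit hWE']
    intro D hDW hD
    have hDK := hKcirc hD
    obtain ⟨w, hw⟩ := hD.nonempty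
    exact Set.disjoint_left.1 hWK (hDW hw) (hDK hw)
  have hWindM : M.Indep W := hWind.of_delete
  have hrW : M.eRk W = 4 := by
    rw [hWindM.eRk_eq_encard, ← hWfin.cast_ncard_eq, hWcard]; rfl
  -- (N) `x ∈ cl (D₁ ∖ {x}) ∩ cl (D₂ ∖ {x})`, two lines whose union has rank `≥ 4`: the intersection has rank `0`
  set P₁ := M.closure (D₁ \ {x}) with hP₁
  set P₂ := M.closure (D₂ \ {x}) with hP₂
  have hxP₁ : x ∈ P₁ := hD₁.1.mem_closure_sdiff_singleton_of_mem hD₁.2.2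
  have hxP₂ : x ∈ P₂ := hD₂.1.mem_closure_sdiff_singleton_of_mem hD₂.2.2
  have hr₁ : M.eRk P₁ ≤ 2 := by
    rw [hP₁, M.eRk_closure_eq]
    calc M.eRk (D₁ \ {x}) ≤ (D₁ \ {x}).encard := M.eRk_le_encard _
      _ = 2 := by
          rw [← (hD₁fin.sdiff).cast_ncard_eq]
          have := Set.ncard_sdiff_singleton_add_one hD₁.2.2 hD₁fin
          rw [hD₁.2.1] at this
          have h2 : (D₁ \ {x}).ncard = 2 := by omega
          rw [h2]; rfl
  have hr₂ : M.eRk P₂ ≤ 2 := by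
    rw [hP₂, M.eRk_closure_eq]
    calc M.eRk (D₂ \ {x}) ≤ (D₂ \ {x}).encard := M.eRk_le_encard _
      _ = 2 := by
          rw [← (hD₂fin.sdiff).cast_ncard_eq]
          have := Set.ncard_sdiff_singleton_add_one hD₂.2.2 hD₂fin
          rw [hD₂.2.1] at this
          have h2 : (D₂ \ {x}).ncard = 2 := by omega
          rw [h2]; rfl
  have hWsub : W ⊆ P₁ ∪ P₂ := by
    intro w hw
    rcases hw.1 with h | h
    · exact Set.mem_union_left _ (M.subset_closure (D₁ \ {x}) (Set.sdiff_subset.trans hD₁E) ⟨h, hw.2⟩)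
    · exact Set.mem_union_right _ (M.subset_closure (D₂ \ {x}) (Set.sdiff_subset.trans hD₂E) ⟨h, hw.2⟩)
  have hrUn : (4 : ℕ∞) ≤ M.eRk (P₁ ∪ P₂) := by
    rw [← hrW]; exact M.eRk_mono hWsub
  have hsub := M.eRk_inter_add_eRk_union_le P₁ P₂
  have hxI : M.eRk ({x} : Set α) ≤ M.eRk (P₁ ∩ P₂) :=
    M.eRk_mono (Set.singleton_subset_iff.2 ⟨hxP₁, hxP₂⟩)
  rw [hx.eRk_eq] at hxI
  have : (1 : ℕ∞) + 4 ≤ 2 + 2 := by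
    calc (1 : ℕ∞) + 4 ≤ M.eRk (P₁ ∩ P₂) + M.eRk (P₁ ∪ P₂) := add_le_add hxI hrUn
      _ ≤ M.eRk P₁ + M.eRk P₂ := hsub
      _ ≤ 2 + 2 := add_le_add hr₁ hr₂
  exact absurd this (by norm_num)

end S1

end PercRepro
-- RE-SEND TEST (um)(38)/(um)(48), p5 g20, 2026-08-25: byte-identical to the landed module d1783 (p397873, commit 28274e8d5949) plus this one comment line; d1783 stays the citation.
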